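import Mathlib
import HarnessLib
import Summits.Ventures.LatticeQCDFlow.Scoring.PooledESS
import Summits.Ventures.LatticeQCDFlow.Scoring.ReweightingMedianOfBlocks

/-!
# Block statistics for the ESS column WITHOUT a weight ceiling: the squared weight at the fourth
# moment (`Var_q w² = M₄ − M₂²`), the printed Kish fraction as the scale-free ratio `W̄²/F̄`, the
# ratio step, and Chebyshev for the block mean squared weight

HONEST FRAMING: exact (Metropolis-corrected) sampling algorithms for lattice gauge theory;
figures of merit are autocorrelation/cost numbers at stated couplings and volumes; no
continuum-physics claim.

Venture `LatticeQCDFlow` (cell pub-lqcd), topic `Scoring`; FANOUT row 4 (`s0-u1-b`, rung S0-B: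
two independent codes compared column by column).  A flow code prints, for each batch of `m`
proposals `y_j` with UNNORMALISED importance weights `w̃_j = c·p(y_j)/q(y_j)` (`c = Z` unknown),
the Kish effective-sample-size fraction `K = (Σ_j w̃_j)² / (m Σ_j w̃_j²) ∈ [0, 1]`; its population
counterpart is `ESS = 1/M₂`, `M₂ = ∫ p²/q dμ = E_q w²` (`w = p/q`).  Row 4's ceiling-free files
(`Scoring/BlockStatisticsCeilingFree`, `…/ReweightingMedianOfBlocks`,
`…/SelfNormalisedReweightingCeilingFree`) treat `M₂ = 1/ESS` as an INPUT and leave 'the ESS column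
itself (kernel `w²` needs a fourth moment)' NOT CLAIMED.  This file supplies the block-level inputs
of that certificate (next file, `Scoring/KishESSCeilingFree`): with the FOURTH weight moment
`M₄ = ∫ p⁴/q³ dμ = E_q w⁴` finite (stated as `Integrable`, no junk Bochner bound) the squared
weight is square-integrable under the model with variance `M₄ − M₂²`, the printed Kish fraction of
a block is the scale-free ratio `W̄²/F̄` of the squared block mean weight to the block mean squared
weight, a deterministic ratio step turns radii for `W̄` and `F̄` into a RELATIVE radius for
`K/ESS = K·M₂`, and `F̄` concentrates by Chebyshev.  NEW WORK of the cell (elementary); nothing is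
cited as a fact; no definition is introduced (`Scoring.kishESS` of `Scoring/PooledESS` is reused;
`AllPairsMedian.integral_sq_weight_model` / `variance_weight_model` and
`ReweightingMedian.blockMean_chebyshev_iid` are imported, not restated).

## Content (`ν = μ.withDensity q`; `w = p/q`; `M₂ = ∫ p²/q dμ`; `M₄ = ∫ p⁴/q³ dμ`;
## `ρ(u, s) = (u(2 + u) + s)/(1 − s)`)

* §1 model-law facts at the fourth moment: `memLp_sqWeight_model` (`w² ∈ L²(ν)` from
  `p⁴/q³ ∈ L¹(μ)`), `integral_fourthWeight_model` (`∫ w⁴ dν = M₄`), **`variance_sqWeight_model`**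
  (`Var_ν w² = M₄ − M₂²`), `one_le_secondMoment_model` (`1 ≤ M₂`, i.e. `ESS ≤ 1`, from
  `Var_ν w = M₂ − 1 ≥ 0`), `fourthMoment_le_of_ceiling` (under a ceiling `p ≤ Wq` the hypothesis is
  automatic: `p⁴/q³ ∈ L¹` and `M₄ ≤ W²M₂`).
* §2 deterministic pieces: `blockKish_scale_free` (the printed fraction does not see `c`),
  `kishFrac_eq_sq_div` (`K = W̄²/F̄`), **`abs_sq_div_mul_sub_one_lt`** (the ratio step:
  `|W̄ − 1| < u`, `|F̄ − M₂| < sM₂`, `s < 1` ⇒ `|K·M₂ − 1| < ρ(u, s)`), `abs_sub_inv_le_of_one_le`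
  (`M₂ ≥ 1` ⇒ `|K − 1/M₂| ≤ |K·M₂ − 1|`: the absolute error is at most the relative one).
* §3 **`blockSqWeightMean_chebyshev_iid`** — `m ≥ 1` independent model draws, `t > 0`:
  `P(t ≤ |F̄ − M₂|) ≤ (M₄ − M₂²)/(m t²)`.

NOT CLAIMED here: anything exponential (next file, via the median of blocks); estimating `M₄`;
any number of ours re-scored.
-/

noncomputable section

namespace Summit.Ventures.LatticeQCDFlow.Scoring.KishESSMedian

open MeasureTheory ProbabilityTheory Finset Real Set
open Summit.Ventures.LatticeQCDFlow.Scoring.BlockMedian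
open Summit.Ventures.LatticeQCDFlow.Scoring.AllPairsMedian
open Summit.Ventures.LatticeQCDFlow.Scoring.ReweightingMedian

/-! ## §1 The squared weight under the model law: fourth moment, variance, `ESS ≤ 1` -/

section Model

variable {X : Type*} [MeasurableSpace X] {μ : Measure X} {p q : X → ℝ}

/-- **`w² = (p/q)² ∈ L²(q dμ)` from `p⁴/q³ ∈ L¹(μ)`** (`((p/q)²)²·q = p⁴/q³`); no ceiling. [ours] -/
theorem memLp_sqWeight_model (hpm : Measurable p) (hq0 : ∀ z, 0 < q z) (hqm : Measurable q)
    (hM4i : Integrable (fun z => p z ^ 4 / q z ^ 3) μ) :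
    MemLp (fun a => (p a / q a) ^ 2) 2 (μ.withDensity fun z => ENNReal.ofReal (q z)) := by
  have hwm : Measurable (fun a => (p a / q a) ^ 2) := (hpm.div hqm).pow_const 2
  rw [memLp_two_iff_integrable_sq hwm.aestronglyMeasurable,
    AllPairsVariance.integrable_withDensity_iff' (fun z => (hq0 z).le) hqm]
  have h : (fun a => ((p a / q a) ^ 2) ^ 2 * q a) = fun a => p a ^ 4 / q a ^ 3 := by
    funext a
    have hqa : q a ≠ 0 := (hq0 a).ne'
    field_simp
  rw [h]
  exact hM4i

/-- `∫ (w²)² d(q dμ) = ∫ p⁴/q³ dμ = M₄` (the fourth weight moment under the model). [ours] -/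
theorem integral_fourthWeight_model (hq0 : ∀ z, 0 < q z) (hqm : Measurable q) :
    ∫ a, ((p a / q a) ^ 2) ^ 2 ∂(μ.withDensity fun z => ENNReal.ofReal (q z))
      = ∫ z, p z ^ 4 / q z ^ 3 ∂μ := by
  rw [AllPairsVariance.integral_withDensity_eq' (fun z => (hq0 z).le) hqm]
  refine integral_congr_ae (Filter.Eventually.of_forall fun a => ?_)
  show ((p a / q a) ^ 2) ^ 2 * q a = p a ^ 4 / q a ^ 3
  have hqa : q a ≠ 0 := (hq0 a).ne'
  field_simp

/-- **`Var_{q dμ} w² = M₄ − M₂²`** (`E_ν (w²)² = M₄`, `E_ν w² = M₂`). [ours] -/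
theorem variance_sqWeight_model
    (hν : IsProbabilityMeasure (μ.withDensity fun z => ENNReal.ofReal (q z)))
    (hpm : Measurable p) (hq0 : ∀ z, 0 < q z) (hqm : Measurable q)
    (hM4i : Integrable (fun z => p z ^ 4 / q z ^ 3) μ) :
    Var[fun a => (p a / q a) ^ 2; μ.withDensity fun z => ENNReal.ofReal (q z)]
      = (∫ z, p z ^ 4 / q z ^ 3 ∂μ) - (∫ z, p z ^ 2 / q z ∂μ) ^ 2 := by
  rw [variance_eq_sub (memLp_sqWeight_model hpm hq0 hqm hM4i)]
  simp only [Pi.pow_apply]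
  rw [integral_fourthWeight_model hq0 hqm, integral_sq_weight_model hq0 hqm]

/-- **`1 ≤ M₂ = ∫ p²/q dμ`, i.e. `ESS ≤ 1`**, for a normalised target (`∫ p = 1`) and a model law
`q dμ` that is a probability measure: `0 ≤ Var_{q dμ} w = M₂ − 1`.  (The tree's
`Exactness.TargetSideParityESS.one_le_integral_sq_div` is the same inequality from `∫ q = 1`.)
[ours] -/
theorem one_le_secondMoment_model
    (hν : IsProbabilityMeasure (μ.withDensity fun z => ENNReal.ofReal (q z)))
    (hpm : Measurable p) (hpi : Integrable p μ) (hp1 : ∫ z, p z ∂μ = 1) (hq0 : ∀ z, 0 < q z)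
    (hqm : Measurable q) (hM2i : Integrable (fun z => p z ^ 2 / q z) μ) :
    1 ≤ ∫ z, p z ^ 2 / q z ∂μ := by
  have h := variance_nonneg (fun a => p a / q a) (μ.withDensity fun z => ENNReal.ofReal (q z))
  rw [variance_weight_model hν hpm hpi hp1 hq0 hqm hM2i] at h
  linarith

/-- **Under a weight ceiling the fourth-moment hypothesis is automatic**: `0 ≤ p ≤ Wq`, `q > 0`,
`p²/q ∈ L¹(μ)` ⇒ `p⁴/q³ ∈ L¹(μ)` and `M₄ = ∫ p⁴/q³ dμ ≤ W² ∫ p²/q dμ = W²M₂`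
(`p⁴/q³ = (p/q)²·(p²/q) ≤ W²·p²/q`). [ours] -/
theorem fourthMoment_le_of_ceiling (hp0 : ∀ z, 0 ≤ p z) (hpm : Measurable p) (hq0 : ∀ z, 0 < q z)
    (hqm : Measurable q) (hM2i : Integrable (fun z => p z ^ 2 / q z) μ) {W : ℝ}
    (hW : ∀ z, p z ≤ W * q z) :
    Integrable (fun z => p z ^ 4 / q z ^ 3) μ
      ∧ ∫ z, p z ^ 4 / q z ^ 3 ∂μ ≤ W ^ 2 * ∫ z, p z ^ 2 / q z ∂μ := by
  have hle : ∀ z, p z ^ 4 / q z ^ 3 ≤ W ^ 2 * (p z ^ 2 / q z) := fun z => by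
    have hqz := hq0 z
    have hw : p z / q z ≤ W := (div_le_iff₀ hqz).2 (hW z)
    have hw0 : 0 ≤ p z / q z := div_nonneg (hp0 z) hqz.le
    have e : p z ^ 4 / q z ^ 3 = (p z / q z) ^ 2 * (p z ^ 2 / q z) := by
      field_simp
    rw [e]
    exact mul_le_mul_of_nonneg_right (pow_le_pow_left₀ hw0 hw 2)
      (div_nonneg (sq_nonneg _) hqz.le)
  have hnn : ∀ z, 0 ≤ p z ^ 4 / q z ^ 3 := fun z =>
    div_nonneg (by positivity) (pow_nonneg (hq0 z).le 3)
  have hint : Integrable (fun z => p z ^ 4 / q z ^ 3) μ := by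
    refine Integrable.mono' (hM2i.const_mul (W ^ 2))
      (((hpm.pow_const 4).div (hqm.pow_const 3)).aestronglyMeasurable)
      (Filter.Eventually.of_forall fun z => ?_)
    rw [Real.norm_eq_abs, abs_of_nonneg (hnn z)]
    exact hle z
  refine ⟨hint, ?_⟩
  calc ∫ z, p z ^ 4 / q z ^ 3 ∂μ ≤ ∫ z, W ^ 2 * (p z ^ 2 / q z) ∂μ :=
        integral_mono hint (hM2i.const_mul _) hle
    _ = W ^ 2 * ∫ z, p z ^ 2 / q z ∂μ := integral_const_mul _ _

end Model

/-! ## §2 Deterministic pieces: scale-freeness, `K = W̄²/F̄`, the ratio step -/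

section Deterministic

variable {X : Type*} {p q : X → ℝ}

/-- **The printed Kish fraction is scale-free**: with `w̃ = c·(p/q)`, `c ≠ 0`, the Kish effective
sample size of a block computed from `w̃` equals the one computed from the normalised weights.
[ours] -/
theorem blockKish_scale_free {wt : X → ℝ} {c : ℝ} (hc : c ≠ 0)
    (hwt : ∀ z, wt z = c * (p z / q z)) {m : ℕ} (v : Fin m → X) :
    kishESS (univ : Finset (Fin m)) (fun j => wt (v j))
      = kishESS (univ : Finset (Fin m)) (fun j => p (v j) / q (v j)) := by
  unfold kishESS
  have e1 : ∑ j : Fin m, wt (v j) = c * ∑ j : Fin m, p (v j) / q (v j) := by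
    rw [Finset.mul_sum]
    exact Finset.sum_congr rfl fun j _ => hwt _
  have e2 : ∑ j : Fin m, wt (v j) ^ 2 = c ^ 2 * ∑ j : Fin m, (p (v j) / q (v j)) ^ 2 := by
    rw [Finset.mul_sum]
    exact Finset.sum_congr rfl fun j _ => by rw [hwt, mul_pow]
  rw [e1, e2, mul_pow]
  rcases eq_or_ne (∑ j : Fin m, (p (v j) / q (v j)) ^ 2) 0 with h | h
  · simp [h]
  · rw [mul_div_mul_left _ _ (pow_ne_zero 2 hc)]

/-- **The Kish fraction is the ratio of the squared mean weight to the mean squared weight**: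
`kishESS/m = (Σ w/m)² / (Σ w²/m)` (Lean's `x/0 = 0` conventions agree on both sides). [ours] -/
theorem kishFrac_eq_sq_div {m : ℕ} (w : Fin m → ℝ) :
    kishESS (univ : Finset (Fin m)) w / m = ((∑ j, w j) / m) ^ 2 / ((∑ j, w j ^ 2) / m) := by
  unfold kishESS
  rcases eq_or_ne (m : ℝ) 0 with hm | hm
  · simp [hm]
  rcases eq_or_ne (∑ j, w j ^ 2) 0 with h | h
  · simp [h]
  field_simp

/-- **The ratio step (relative error of the printed Kish fraction).**  If the block mean weight
is within `u` of `1` and the block mean squared weight within `sM` of `M > 0` (`u ≥ 0`, `s < 1`),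
then `K·M = (W̄²/F̄)·M` is within `ρ(u, s) = (u(2 + u) + s)/(1 − s)` of `1`:
`|a − 1| < u`, `|F − M| < sM` ⇒ `|a²/F·M − 1| < (u(2 + u) + s)/(1 − s)`
(`|a² − 1| ≤ |a − 1|(|a − 1| + 2) < u(2 + u)`, `|Ma² − F| < M(u(2 + u) + s)`, `F > (1 − s)M`).
[ours] -/
theorem abs_sq_div_mul_sub_one_lt {a F M u s : ℝ} (hM : 0 < M) (hu : 0 ≤ u) (hs1 : s < 1)
    (ha : |a - 1| < u) (hF : |F - M| < s * M) :
    |a ^ 2 / F * M - 1| < (u * (2 + u) + s) / (1 - s) := by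
  have hG : 0 < (1 - s) * M := mul_pos (by linarith) hM
  have hFlo : (1 - s) * M < F := by
    have := (abs_lt.1 hF).1
    linarith
  have hF0 : 0 < F := hG.trans hFlo
  have h1 : |a ^ 2 - 1| ≤ |a - 1| * (|a - 1| + 2) := by
    rw [show a ^ 2 - 1 = (a - 1) * (a + 1) by ring, abs_mul]
    refine mul_le_mul_of_nonneg_left ?_ (abs_nonneg _)
    calc |a + 1| = |(a - 1) + 2| := by congr 1; ring
      _ ≤ |a - 1| + |(2 : ℝ)| := abs_add_le _ _
      _ = |a - 1| + 2 := by norm_num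
  have h2 : |a - 1| * (|a - 1| + 2) < u * (2 + u) := by nlinarith [abs_nonneg (a - 1)]
  have h3 : |M * a ^ 2 - F| < M * (u * (2 + u) + s) := by
    calc |M * a ^ 2 - F| = |M * (a ^ 2 - 1) + (M - F)| := by congr 1; ring
      _ ≤ |M * (a ^ 2 - 1)| + |M - F| := abs_add_le _ _
      _ = M * |a ^ 2 - 1| + |F - M| := by rw [abs_mul, abs_of_pos hM, abs_sub_comm M F]
      _ < M * (u * (2 + u)) + s * M :=
          add_lt_add_of_le_of_lt (mul_le_mul_of_nonneg_left (h1.trans h2.le) hM.le) hF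
      _ = M * (u * (2 + u) + s) := by ring
  have e : a ^ 2 / F * M - 1 = (M * a ^ 2 - F) / F := by
    field_simp
  rw [e, abs_div, abs_of_pos hF0]
  calc |M * a ^ 2 - F| / F ≤ |M * a ^ 2 - F| / ((1 - s) * M) :=
        div_le_div_of_nonneg_left (abs_nonneg _) hG hFlo.le
    _ < M * (u * (2 + u) + s) / ((1 - s) * M) := div_lt_div_of_pos_right h3 hG
    _ = (u * (2 + u) + s) / (1 - s) := by
        rw [mul_comm (1 - s) M, mul_div_mul_left _ _ hM.ne']

/-- **Absolute from relative**: for `M ≥ 1` (`ESS = 1/M ≤ 1`), `|K − 1/M| ≤ |K·M − 1|`. [ours] -/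
theorem abs_sub_inv_le_of_one_le {K M : ℝ} (hM : 1 ≤ M) : |K - M⁻¹| ≤ |K * M - 1| := by
  have hM0 : 0 < M := one_pos.trans_le hM
  have e : K - M⁻¹ = (K * M - 1) / M := by
    field_simp
  rw [e, abs_div, abs_of_pos hM0]
  exact div_le_self (abs_nonneg _) hM

end Deterministic

/-! ## §3 Chebyshev for the block mean squared weight -/

section Chebyshev

variable {Ω : Type*} [MeasurableSpace Ω] {P : Measure Ω} [IsProbabilityMeasure P]
variable {X : Type*} [MeasurableSpace X] {μ : Measure X} {p q : X → ℝ} {n m R : ℕ}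

/-- **CHEBYSHEV FOR THE MEAN SQUARED WEIGHT OF `m` INDEPENDENT MODEL DRAWS, ceiling-free**:
`P(t ≤ |F̄ − M₂|) ≤ (M₄ − M₂²)/(m t²)`, `F̄ = Σ_{j<m} w(x_j)²/m` (the squared weights are
independent with mean `M₂` and variance `M₄ − M₂²`). [ours] -/
theorem blockSqWeightMean_chebyshev_iid {x : Fin m → Ω → X} (hxm : ∀ j, Measurable (x j))
    (hind : iIndepFun x P) (hpm : Measurable p) (hq0 : ∀ z, 0 < q z) (hqm : Measurable q)
    (hM4i : Integrable (fun z => p z ^ 4 / q z ^ 3) μ)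
    (hlaw : ∀ j, Measure.map (x j) P = μ.withDensity fun z => ENNReal.ofReal (q z))
    (hm : 1 ≤ m) {t : ℝ} (ht : 0 < t) :
    P.real {ω | t ≤ |(∑ j : Fin m, (p (x j ω) / q (x j ω)) ^ 2) / m - ∫ z, p z ^ 2 / q z ∂μ|}
      ≤ ((∫ z, p z ^ 4 / q z ^ 3 ∂μ) - (∫ z, p z ^ 2 / q z ∂μ) ^ 2) / (m * t ^ 2) := by
  have hν : IsProbabilityMeasure (μ.withDensity fun z => ENNReal.ofReal (q z)) :=
    isProbabilityMeasure_of_map_eq_iid (hxm ⟨0, hm⟩) (hlaw ⟨0, hm⟩)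
  have h := blockMean_chebyshev_iid (ν := μ.withDensity fun z => ENNReal.ofReal (q z))
    hxm hind hlaw (g := fun a => (p a / q a) ^ 2) ((hpm.div hqm).pow_const 2)
    (memLp_sqWeight_model hpm hq0 hqm hM4i) hm ht
  rw [integral_sq_weight_model hq0 hqm, variance_sqWeight_model hν hpm hq0 hqm hM4i] at h
  exact h

end Chebyshev

end Summit.Ventures.LatticeQCDFlow.Scoring.KishESSMedian

end
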